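import Summits.QuantumFields.YangMills.Theorems.BalabanUVNodesN07MultiScaleLiftsRightInverse
import HarnessLib

/-!
# BalabanUVNodes ∕ N07 — THE AVERAGING OF RECORD IS `C¹` ALONG THE EXPONENTIAL CHART UNDER A SUPPORT-LOCALISED GUARD:
# the `hsm` hypothesis of `Node00.MultiScaleFibreChartLocal` ∕ `…N07MultiScaleLiftsRightInverse` discharged from the (0.4) small-field guard on the
# block tower under the constrained bonds only (a downward-closed bond family), not on the whole torus

Cell `pub-ymgap`, width seat `pub-ymgap-dag-n07-w2` generation 2 (HUMAN RULING D-0149; DAG node N07 = [15] = [Balaban1985Variational]; W-SEAT START LIST §n07 S2,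
successor piece (A) of n07-w2 g0's HANDOFF = dag-n07-e g14's OFFER (cell bus l.25250, trigger t2): «a SUPPORT-LOCALISED twin of `coeField_iter_eq_iterM` ∕
`contDiffAt_iterM_expChart` — guard only on the input cone of ONE coarse bond — would discharge the `hsm` hypothesis of `MultiScaleFibreChartLocal` ∕ `…of_levelLifts` on
stub 1's TOP-DOMAIN class»).  `--kind proof --supports stmt-QuantumFields-20542 --as helper` (K1⁷; count-neutral; theorems only).  CONSUMED BY NAME, nothing modified:
n07-e's 35b-i `Node00.AveragingSmooth` (`coeField`, `loopM`, `avgM`, `contDiff_loopM`, `contDiffAt_corrM`, `contDiff_axialM`, `coe_loopHol`, `coe_avgFun_of_small`,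
`norm_loopM_coeField_sub_one_lt(_one)`, `contDiff_coeField_expChart`), the tree's `BlockAveraging.avgFun_local` (the (0.4) window `blockOf b₋ ∈ {c₋, c₊}`), 35a's `expChart` ∕
`expChart_zero`, n07-w2 g0's `Node00.MultiScaleFibreChartLocal` (`isFibreChartNear_msChart_of_smooth`, `hasDerivAt_wilsonAction4_expChart_of_isCritOnFibre_of_smooth_of_rightInverse`) and
`Thm.BalabanUVNodesN07MultiScaleLiftsRightInverse` (`exists_velocity_preimage_of_levelLifts`, `isFibreChartNear_msChart_of_levelLifts`, `hasDerivAt_wilsonAction4_expChart_of_isCritOnFibre_of_levelLifts`).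

WHY.  The multi-scale tangent form (35g′) is in the tree MODULO two displayed hypotheses: the per-level LIFTS `hlift` and the LOCAL SMOOTHNESS `hsm` — each of the finitely many
constrained outputs `X ↦ Ū^j(U·exp X)(c)`, `(j, c)` a constrained bond, is `C¹` at `X = 0`.  File 1 of the w2 lane (`MultiScaleFibreChart`) gets `hsm` from the GLOBAL guard
`SmallBelow (avOfRecord F N K) k U` ((0.4)'s small-field condition at EVERY coarse bond of the torus below level `k`); stub 1's TOP-DOMAIN class ([15] (6) with the scale-`0` members
on `Ω₀ = Sup` only) controls the field only on the top domain, so the global guard is not available.  But `Ū^{j+1}(c)` reads `Ū^j` only on the (0.4) window of `c` (the fine bonds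
issuing from the two blocks `B(c₋)`, `B(c₊)`: `Averaging.local_dep` ∕ `BlockAveraging.avgFun_local`), so the guard is needed only down the block tower under the constrained bonds.
THIS FILE proves exactly that, in three steps: (§1) the ONE-BOND `C^n` BRICK — for ANY map `Φ : E → SU(N)^{bonds_j}` from a real normed space, if the loop variables of `Φ x₀` AT `c`
lie inside the guard and the window coordinates `x ↦ Φ x b` (as matrices) are `C^n` at `x₀`, then `x ↦ Ū(Φ x)(c)` is `C^n` at `x₀` (splice `Φ x` with the frozen `Φ x₀` off the
window — n07-e's device of `…N07AveragingLocalContinuity` —; the spliced field is `C^n` into the product; near `x₀` its guard persists, where the output IS the `C^∞` matrix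
extension `avgM` of 35b-i; `eventually_small_comp_of_small_of_local` records that the guard AT `c` persists under mere continuity of the window coordinates); (§2) the TOWER along the chart `X ↦ U·exp X` under the guard on any DOWNWARD-CLOSED bond family `S` (closed under the window relation; the consumer's
choice — e.g. the bonds whose block towers sit inside the guarded region with its collars; `S ≡ univ` recovers the global road); (§3) `hsm` for a level-bounded determining set whose
constrained bonds lie in `S`, and the three consumers re-keyed on that guard: 35a's `IsFibreChartNear` for the canonical chart, and «curve-critical ⇒ tangent-critical» on the
multi-scale fibre, modulo (45) at `U` resp. modulo the per-level lifts.

HONEST FRAMING: kernel calculus about the tree's own averaging map; no definition; the guard on `S`, the closure of `S`, the right inverse (45) at `U` (`hH`) resp. the lifts (`hlift`)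
are DISPLAYED HYPOTHESES (the global guard inhabits the first two, §2); nothing of [15] asserted; stub 1 ∕ K0⁷ NOT closed; N07 NOT discharged; counts unmoved (5∕27); one finite T⁴
programme at fixed ε — NOT continuum ∕ ℝ⁴ ∕ OS ∕ mass gap ∕ Clay (R4 closes the conditional rung `BalabanLadder.UV` only).  No `sorry`, no `instance`, no `notation`.
-/

noncomputable section

open scoped Matrix.Norms.L2Operator Topology
open Filter

namespace Summit.QuantumFields.YangMills.BalabanUVNodes.N07AveragingLocalSmooth

open Literature.MathematicalPhysics.QuantumFieldTheory.Balaban1983to89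
open Literature.MathematicalPhysics.QuantumFieldTheory.Balaban1983to89.T4Continuum (T4Family)
open Literature.MathematicalPhysics.QuantumFieldTheory.Balaban1983to89.B15DeterminingSets
open Literature.MathematicalPhysics.QuantumFieldTheory.Balaban1983to89.T4AdjointCovarianceUnitary (lieSU)
open Literature.MathematicalPhysics.QuantumFieldTheory.Balaban1983to89.BlockAveraging (Small Idx loopHol avgFun avgFun_local)
open Literature.MathematicalPhysics.QuantumFieldTheory.Balaban1983to89.ExpMeanLog (expMeanLogSU deltaSU)
open Literature.MathematicalPhysics.QuantumFieldTheory.Balaban1983to89.Node00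

/-! ## §1  One coarse bond: the `C^n` brick (guard AT `c` + `C^n` window coordinates ⇒ `C^n` output) -/

section OneBond

variable {P : Params} {j : ℕ} {N : ℕ}

/-- **PER-BOND SMOOTHNESS OF THE MATRIX EXTENSION**: `V ↦ avgM V c` is `C^n` at every field whose (0.4) loop matrices AT `c` lie in the polydisc `‖W − 1‖ < 1` — the `c`-component
of 35b-i's `contDiffAt_avgM`, asking nothing at other coarse bonds. [cite: Balaban1987RG1, (0.4) p.253 («we assume that it is an analytic function»)] -/
theorem contDiffAt_avgM_apply {n : WithTop ℕ∞} {V₀ : PBond P j → Matrix (Fin N) (Fin N) ℂ} (c : PBond P (j + 1))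
    (h : ∀ i : Idx P, ‖loopM V₀ c i - 1‖ < 1) :
    ContDiffAt ℝ n (fun V : PBond P j → Matrix (Fin N) (Fin N) ℂ => avgM V c) V₀ :=
  ((contDiffAt_corrM c h).mul (contDiff_axialM c).contDiffAt).of_le le_top

variable [NeZero N]

/-- ★ **LOCALITY ⇒ LOCAL SMOOTHNESS (the one-bond `C^n` brick).**  Let `Φ : E → SU(N)^{bonds_j}` be any map from a real normed space, `x₀ ∈ E`, `c` a coarse bond, standing
range `j + 1 ≤ m + K`.  If the (0.4) loop variables of `Φ x₀` AT `c` lie inside the guard and each window coordinate `x ↦ Φ x b` (`blockOf b₋ = c₋` or `= c₊` — the only fine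
bonds `Ū(·)(c)` reads, `BlockAveraging.avgFun_local`), read as a matrix, is `C^n` at `x₀`, then `x ↦ Ū(Φ x)(c)` (read as a matrix) is `C^n` at `x₀`.  Proof: splice `Φ x` with
the frozen `Φ x₀` off the window; the spliced field is `C^n` into `M_N(ℂ)^{bonds_j}`, its guard AT `c` persists near `x₀` (finitely many strict inequalities on continuous loop
matrices), and there the output is 35b-i's `C^∞` matrix extension `avgM` of the spliced field (`coe_avgFun_of_small`), whose loop matrices at `x₀` are in the polydisc.
[cite: Balaban1987RG1, (0.4) p.253; Balaban1985Averaging, p.19 (locality)] -/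
theorem contDiffAt_coe_avgFun_comp_apply_of_small_of_local {E : Type*} [NormedAddCommGroup E] [NormedSpace ℝ E] {n : WithTop ℕ∞}
    (hj : j + 1 ≤ P.m + P.K) {Φ : E → GaugeField P j (SU N)} {x₀ : E} (c : PBond P (j + 1))
    (hsmall : Small (expMeanLogSU (n := Fin N)) (Φ x₀) c)
    (hloc : ∀ b : PBond P j, (blockOf b.src = c.src ∨ blockOf b.src = c.tgt) →
      ContDiffAt ℝ n (fun x => ((Φ x b : SU N) : Matrix (Fin N) (Fin N) ℂ)) x₀) :
    ContDiffAt ℝ n (fun x => ((avgFun (expMeanLogSU (n := Fin N)) (Φ x) c : SU N) : Matrix (Fin N) (Fin N) ℂ)) x₀ := by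
  classical
  -- the splice: `Φ x` on the window of `c`, the frozen `Φ x₀` elsewhere
  let Ψ : E → GaugeField P j (SU N) := fun x b =>
    if blockOf b.src = c.src ∨ blockOf b.src = c.tgt then Φ x b else Φ x₀ b
  have hΨ0 : Ψ x₀ = Φ x₀ := by
    funext b
    show (if blockOf b.src = c.src ∨ blockOf b.src = c.tgt then Φ x₀ b else Φ x₀ b) = Φ x₀ b
    split_ifs <;> rfl
  -- the spliced field of matrices is `C^n` at `x₀`
  have hΨ : ContDiffAt ℝ n (fun x => coeField (Ψ x)) x₀ := by
    refine contDiffAt_pi.2 fun b => ?_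
    by_cases hb : blockOf b.src = c.src ∨ blockOf b.src = c.tgt
    · have e : (fun x => coeField (Ψ x) b) = fun x => ((Φ x b : SU N) : Matrix (Fin N) (Fin N) ℂ) :=
        funext fun x => congrArg (fun g : SU N => (g : Matrix (Fin N) (Fin N) ℂ)) (if_pos hb)
      rw [e]
      exact hloc b hb
    · have e : (fun x => coeField (Ψ x) b) = fun _ => ((Φ x₀ b : SU N) : Matrix (Fin N) (Fin N) ℂ) :=
        funext fun x => congrArg (fun g : SU N => (g : Matrix (Fin N) (Fin N) ℂ)) (if_neg hb)
      rw [e]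
      exact contDiffAt_const
  -- the guard AT `c` persists near `x₀`
  have hguard : ∀ᶠ x in 𝓝 x₀, Small (expMeanLogSU (n := Fin N)) (Ψ x) c := by
    have hi : ∀ i : Idx P, ∀ᶠ x in 𝓝 x₀, ‖loopM (coeField (Ψ x)) c i - 1‖ < deltaSU (Fin N) := fun i => by
      have hf : ContinuousAt (fun x => ‖loopM (coeField (Ψ x)) c i - 1‖) x₀ :=
        (((contDiff_loopM c i).continuous.continuousAt.comp hΨ.continuousAt).sub continuousAt_const).norm
      have h0 : ‖loopM (coeField (Ψ x₀)) c i - 1‖ < deltaSU (Fin N) := by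
        rw [hΨ0]
        exact norm_loopM_coeField_sub_one_lt _ c hsmall i
      exact hf.tendsto.eventually_lt_const h0
    refine (eventually_all.2 hi).mono fun x hx i => ?_
    have h := hx i
    rw [← coe_loopHol] at h
    exact h
  -- near `x₀` the output IS the smooth matrix extension of the spliced field
  have heq : (fun x => ((avgFun (expMeanLogSU (n := Fin N)) (Φ x) c : SU N) : Matrix (Fin N) (Fin N) ℂ)) =ᶠ[𝓝 x₀]
      fun x => avgM (coeField (Ψ x)) c :=
    hguard.mono fun x hx => by
      show ((avgFun (expMeanLogSU (n := Fin N)) (Φ x) c : SU N) : Matrix (Fin N) (Fin N) ℂ) = avgM (coeField (Ψ x)) c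
      rw [avgFun_local _ hj (Φ x) (Ψ x) c fun b hb => (if_pos hb).symm]
      exact coe_avgFun_of_small _ c hx
  have hg : ContDiffAt ℝ n (fun V : PBond P j → Matrix (Fin N) (Fin N) ℂ => avgM V c) (coeField (Ψ x₀)) := by
    rw [hΨ0]
    exact contDiffAt_avgM_apply c fun i => norm_loopM_coeField_sub_one_lt_one _ c hsmall i
  have hcomp := hg.comp x₀ hΨ
  exact hcomp.congr_of_eventuallyEq heq

/-- ★ **THE GUARD AT `c` PERSISTS NEAR `x₀` UNDER CONTINUITY OF THE WINDOW COORDINATES** (any topological space `X`, standing range): if the loop variables of `Φ x₀` AT `c` lie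
inside the guard and each window coordinate `x ↦ Φ x b` (read as a matrix) is continuous at `x₀`, then `Small (Φ x) c` for all `x` near `x₀` — the loop variables at `c` read the
window only (`BlockAveraging.loopHol_local`), and the guard is a finite family of strict inequalities on continuous loop matrices. [cite: Balaban1987RG1, (0.4) p.253; Balaban1985Averaging, p.19 (locality)] -/
theorem eventually_small_comp_of_small_of_local {X : Type*} [TopologicalSpace X] (hj : j + 1 ≤ P.m + P.K) {Φ : X → GaugeField P j (SU N)} {x₀ : X}
    (c : PBond P (j + 1)) (hsmall : Small (expMeanLogSU (n := Fin N)) (Φ x₀) c)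
    (hloc : ∀ b : PBond P j, (blockOf b.src = c.src ∨ blockOf b.src = c.tgt) →
      ContinuousAt (fun x => ((Φ x b : SU N) : Matrix (Fin N) (Fin N) ℂ)) x₀) :
    ∀ᶠ x in 𝓝 x₀, Small (expMeanLogSU (n := Fin N)) (Φ x) c := by
  classical
  let Ψ : X → GaugeField P j (SU N) := fun x b =>
    if blockOf b.src = c.src ∨ blockOf b.src = c.tgt then Φ x b else Φ x₀ b
  have hΨ0 : Ψ x₀ = Φ x₀ := by
    funext b
    show (if blockOf b.src = c.src ∨ blockOf b.src = c.tgt then Φ x₀ b else Φ x₀ b) = Φ x₀ b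
    split_ifs <;> rfl
  have hΨ : ContinuousAt (fun x => coeField (Ψ x)) x₀ := by
    refine continuousAt_pi.2 fun b => ?_
    by_cases hb : blockOf b.src = c.src ∨ blockOf b.src = c.tgt
    · have e : (fun x => coeField (Ψ x) b) = fun x => ((Φ x b : SU N) : Matrix (Fin N) (Fin N) ℂ) :=
        funext fun x => congrArg (fun g : SU N => (g : Matrix (Fin N) (Fin N) ℂ)) (if_pos hb)
      rw [e]
      exact hloc b hb
    · have e : (fun x => coeField (Ψ x) b) = fun _ => ((Φ x₀ b : SU N) : Matrix (Fin N) (Fin N) ℂ) :=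
        funext fun x => congrArg (fun g : SU N => (g : Matrix (Fin N) (Fin N) ℂ)) (if_neg hb)
      rw [e]
      exact continuousAt_const
  have hi : ∀ i : Idx P, ∀ᶠ x in 𝓝 x₀, ‖loopM (coeField (Ψ x)) c i - 1‖ < deltaSU (Fin N) := fun i => by
    have hf : ContinuousAt (fun x => ‖loopM (coeField (Ψ x)) c i - 1‖) x₀ :=
      (((contDiff_loopM c i).continuous.continuousAt.comp hΨ).sub continuousAt_const).norm
    have h0 : ‖loopM (coeField (Ψ x₀)) c i - 1‖ < deltaSU (Fin N) := by
      rw [hΨ0]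
      exact norm_loopM_coeField_sub_one_lt _ c hsmall i
    exact hf.tendsto.eventually_lt_const h0
  refine (eventually_all.2 hi).mono fun x hx => ?_
  have hΨx : Small (expMeanLogSU (n := Fin N)) (Ψ x) c := fun i => by
    have h := hx i
    rw [← coe_loopHol] at h
    exact h
  unfold BlockAveraging.Small at hΨx ⊢
  rw [BlockAveraging.loopHol_local hj (Φ x) (Ψ x) c fun b hb => (if_pos hb).symm]
  exact hΨx

end OneBond

/-! ## §2  The tower along the exponential chart at NODE 00's objects, under the guard on a downward-closed bond family -/

section Tower

variable {F : T4Family} {N : ℕ} [NeZero N] {K : ℕ} {U : GaugeField (F.P K) 0 (SU N)}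

/-- **LEVEL `0`**: `X ↦ Ū^0(U·exp X)(b) = U(b)·exp X(b)` is `C^n` (35b-i `contDiff_coeField_expChart`, read at one bond). [cite: Balaban1985RegularSpaces, (1.10) p.77 (bookkeeping)] -/
theorem contDiffAt_coe_avgFamily_expChart_zero {n : WithTop ℕ∞} (b : PBond (F.P K) 0) :
    ContDiffAt ℝ n (fun X : PBond (F.P K) 0 → lieSU (Fin N) =>
      ((avgFamily (avOfRecord F N K) (expChart U X) 0 b : SU N) : Matrix (Fin N) (Fin N) ℂ)) 0 :=
  ((contDiffAt_pi.1 (contDiff_coeField_expChart U).contDiffAt) b).of_le le_top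

/-- ★ **ONE STEP UP THE BLOCK TOWER ALONG THE CHART**: `X ↦ Ū^{j+1}(U·exp X)(c)` is `C^n` at `X = 0` as soon as the loop variables of `Ū^j(U)` AT `c` lie inside the guard and
`X ↦ Ū^j(U·exp X)(b)` is `C^n` at `0` for every fine bond `b` in the window of `c` (standing range `j + 1 ≤ m + K`) — §1's brick at `Φ := X ↦ Ū^j(U·exp X)`.
[cite: Balaban1987RG1, (0.4), (0.11) p.253; Balaban1985Variational, (2)–(3) p.278] -/
theorem contDiffAt_coe_avgFamily_expChart_succ_of_small_of_local {n : WithTop ℕ∞} {j : ℕ} (hj : j + 1 ≤ (F.P K).m + (F.P K).K)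
    (c : PBond (F.P K) (j + 1)) (hsmall : Small (expMeanLogSU (n := Fin N)) (avgFamily (avOfRecord F N K) U j) c)
    (hloc : ∀ b : PBond (F.P K) j, (blockOf b.src = c.src ∨ blockOf b.src = c.tgt) →
      ContDiffAt ℝ n (fun X : PBond (F.P K) 0 → lieSU (Fin N) =>
        ((avgFamily (avOfRecord F N K) (expChart U X) j b : SU N) : Matrix (Fin N) (Fin N) ℂ)) 0) :
    ContDiffAt ℝ n (fun X : PBond (F.P K) 0 → lieSU (Fin N) =>
      ((avgFamily (avOfRecord F N K) (expChart U X) (j + 1) c : SU N) : Matrix (Fin N) (Fin N) ℂ)) 0 := by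
  have h0 : Small (expMeanLogSU (n := Fin N))
      ((fun X : PBond (F.P K) 0 → lieSU (Fin N) => avgFamily (avOfRecord F N K) (expChart U X) j) 0) c := by
    show Small (expMeanLogSU (n := Fin N)) (avgFamily (avOfRecord F N K) (expChart U 0) j) c
    rw [expChart_zero]
    exact hsmall
  exact contDiffAt_coe_avgFun_comp_apply_of_small_of_local (n := n) hj
    (Φ := fun X : PBond (F.P K) 0 → lieSU (Fin N) => avgFamily (avOfRecord F N K) (expChart U X) j) c h0 hloc

/-- ★★ **THE TOWER UNDER A SUPPORT-LOCALISED GUARD.**  Let `S = (S_i)` be a family of bond sets CLOSED DOWNWARD under the (0.4) window below level `k` (`c ∈ S_{i+1}`, `blockOf b₋ ∈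
{c₋, c₊}` ⇒ `b ∈ S_i`), `k` in the standing range, and suppose the guard holds at every `c ∈ S_{i+1}`, `i + 1 ≤ k`, for the iterates `Ū^i(U)`.  Then EVERY output `X ↦ Ū^i(U·exp X)(b)`,
`i ≤ k`, `b ∈ S_i`, is `C^n` at `X = 0`.  (`S ≡ univ` is file 1's global road `SmallBelow`; a TOP-DOMAIN consumer takes the bonds whose block towers sit inside its guarded region.)
[cite: Balaban1987RG1, (0.4), (0.11) p.253, (0.21) p.256; Balaban1985Variational, (2)–(3), (6) p.278] -/
theorem contDiffAt_coe_avgFamily_expChart_of_small_on_closedBelow {n : WithTop ℕ∞} {k : ℕ} (hk : k ≤ (F.P K).m + (F.P K).K)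
    (S : (i : ℕ) → Set (PBond (F.P K) i))
    (hS : ∀ (i : ℕ) (c : PBond (F.P K) (i + 1)), i + 1 ≤ k → c ∈ S (i + 1) →
      ∀ b : PBond (F.P K) i, (blockOf b.src = c.src ∨ blockOf b.src = c.tgt) → b ∈ S i)
    (hg : ∀ (i : ℕ) (c : PBond (F.P K) (i + 1)), i + 1 ≤ k → c ∈ S (i + 1) →
      Small (expMeanLogSU (n := Fin N)) (avgFamily (avOfRecord F N K) U i) c) :
    ∀ i, i ≤ k → ∀ b ∈ S i, ContDiffAt ℝ n (fun X : PBond (F.P K) 0 → lieSU (Fin N) =>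
      ((avgFamily (avOfRecord F N K) (expChart U X) i b : SU N) : Matrix (Fin N) (Fin N) ℂ)) 0
  | 0, _, b, _ => contDiffAt_coe_avgFamily_expChart_zero b
  | i + 1, hi, c, hc =>
    contDiffAt_coe_avgFamily_expChart_succ_of_small_of_local (hi.trans hk) c (hg i c hi hc) fun b hb =>
      contDiffAt_coe_avgFamily_expChart_of_small_on_closedBelow hk S hS hg i (Nat.le_of_succ_le hi) b (hS i c hi hc b hb)

/-- **THE GLOBAL GUARD INHABITS THE HYPOTHESES** (`S ≡ univ`): under `SmallBelow (avOfRecord F N K) k U`, `k` in the standing range, every output `X ↦ Ū^j(U·exp X)(c)`, `j ≤ k`,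
is `C^n` at `0` — file 1's `contDiffAt_coe_avgFamily_expChart_of_smallBelow` re-derived by the local road (consistency certificate for §2's antecedent). [cite: Balaban1987RG1, (0.4) p.253, (0.21) p.256] -/
theorem contDiffAt_coe_avgFamily_expChart_of_smallBelow' {n : WithTop ℕ∞} {k : ℕ} (hk : k ≤ (F.P K).m + (F.P K).K)
    (hsb : SmallBelow (avOfRecord F N K) k U) {j : ℕ} (hj : j ≤ k) (c : PBond (F.P K) j) :
    ContDiffAt ℝ n (fun X : PBond (F.P K) 0 → lieSU (Fin N) =>
      ((avgFamily (avOfRecord F N K) (expChart U X) j c : SU N) : Matrix (Fin N) (Fin N) ℂ)) 0 :=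
  contDiffAt_coe_avgFamily_expChart_of_small_on_closedBelow hk (fun _ => Set.univ) (fun _ _ _ _ _ _ => Set.mem_univ _)
    (fun i c hi _ => hsb i hi c) j hj c (Set.mem_univ c)

end Tower

/-! ## §3  `hsm` of `MultiScaleFibreChartLocal` ∕ `…MultiScaleLiftsRightInverse` from the support-localised guard, and the three consumers re-keyed on it -/

section Constrained

variable {F : T4Family} {N : ℕ} [NeZero N]
variable {K k : ℕ} {𝔹 : DetSet (F.P K)} {W : MSField (F.P K) (SU N)} {U : GaugeField (F.P K) 0 (SU N)}

/-- ★★★ **`hsm` DISCHARGED FROM A SUPPORT-LOCALISED GUARD**: if the constrained bonds of `𝐁` up to level `k` (standing range) lie in a downward-closed bond family `S` on which the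
(0.4) guard holds for the iterates of `U`, then every constrained output `X ↦ Ū^j(U·exp X)(c)`, `j ≤ k`, `c ∈ bonds(Γ_j)`, is `C¹` at `X = 0` — verbatim the hypothesis `hsm` of
`Node00.MultiScaleFibreChartLocal.isFibreChartNear_msChart_of_smooth` ∕ `…of_smooth_of_rightInverse` and of `…N07MultiScaleLiftsRightInverse.…_of_levelLifts`.
[cite: Balaban1985Variational, (2)–(3), (6) p.278, (82)–(83) p.290; Balaban1987RG1, (0.4) p.253; Balaban1988Convergent, (2.10)–(2.11) p.256] -/
theorem contDiffAt_constrained_of_small_on_closedBelow (hk : k ≤ (F.P K).m + (F.P K).K)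
    (S : (i : ℕ) → Set (PBond (F.P K) i))
    (hS : ∀ (i : ℕ) (c : PBond (F.P K) (i + 1)), i + 1 ≤ k → c ∈ S (i + 1) →
      ∀ b : PBond (F.P K) i, (blockOf b.src = c.src ∨ blockOf b.src = c.tgt) → b ∈ S i)
    (hg : ∀ (i : ℕ) (c : PBond (F.P K) (i + 1)), i + 1 ≤ k → c ∈ S (i + 1) →
      Small (expMeanLogSU (n := Fin N)) (avgFamily (avOfRecord F N K) U i) c)
    (h𝔹S : ∀ j, j ≤ k → bondsOf (𝔹 j) ⊆ S j) :
    ∀ j, j ≤ k → ∀ c ∈ bondsOf (𝔹 j), ContDiffAt ℝ 1 (fun X : PBond (F.P K) 0 → lieSU (Fin N) =>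
      ((avgFamily (avOfRecord F N K) (expChart U X) j c : SU N) : Matrix (Fin N) (Fin N) ℂ)) 0 :=
  fun j hj c hc => contDiffAt_coe_avgFamily_expChart_of_small_on_closedBelow hk S hS hg j hj c (h𝔹S j hj hc)

/-- ★★ **35a's `IsFibreChartNear` FOR THE CANONICAL MULTI-SCALE CHART UNDER A SUPPORT-LOCALISED GUARD, MODULO (45) AT `U`** (`isFibreChartNear_msChart_of_smooth` with `hsm` supplied by
§3). [cite: Balaban1985Variational, (45)–(48) p.285, Prop. 3 p.289, (82)–(83) p.290; Balaban1988Convergent, (2.10)–(2.12) p.256] -/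
theorem isFibreChartNear_msChart_of_small_on_closedBelow (h𝔹 : ∀ j, k < j → 𝔹 j = ∅) (hk : k ≤ (F.P K).m + (F.P K).K)
    (hU : AgreeOn 𝔹 (avgFamily (avOfRecord F N K) U) W)
    (S : (i : ℕ) → Set (PBond (F.P K) i))
    (hS : ∀ (i : ℕ) (c : PBond (F.P K) (i + 1)), i + 1 ≤ k → c ∈ S (i + 1) →
      ∀ b : PBond (F.P K) i, (blockOf b.src = c.src ∨ blockOf b.src = c.tgt) → b ∈ S i)
    (hg : ∀ (i : ℕ) (c : PBond (F.P K) (i + 1)), i + 1 ≤ k → c ∈ S (i + 1) →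
      Small (expMeanLogSU (n := Fin N)) (avgFamily (avOfRecord F N K) U i) c)
    (h𝔹S : ∀ j, j ≤ k → bondsOf (𝔹 j) ⊆ S j)
    (hH : ∀ τ : (j : ℕ) → PBond (F.P K) j → lieSU (Fin N), ∃ X : PBond (F.P K) 0 → lieSU (Fin N), ∀ j, j ≤ k → ∀ c ∈ bondsOf (𝔹 j),
      HasDerivAt (fun t : ℝ => ((avgFamily (avOfRecord F N K) (expChart U (t • X)) j c : SU N) : Matrix (Fin N) (Fin N) ℂ))
        (((W j c : SU N) : Matrix (Fin N) (Fin N) ℂ) * ((τ j c : lieSU (Fin N)) : Matrix (Fin N) (Fin N) ℂ)) 0) :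
    IsFibreChartNear F N K 𝔹 W U (msChart F N K k 𝔹 W U) (fderiv ℝ (msChart F N K k 𝔹 W U) 0) :=
  isFibreChartNear_msChart_of_smooth h𝔹 hU (contDiffAt_constrained_of_small_on_closedBelow hk S hS hg h𝔹S) hH

/-- ★★★ **CURVE-CRITICAL ⇒ TANGENT-CRITICAL ON A MULTI-SCALE FIBRE UNDER A SUPPORT-LOCALISED GUARD, MODULO [15] (45) AT `U`**: `𝐁` level-bounded in the standing range, `U` in the fibre,
the (0.4) guard on a downward-closed bond family containing the constrained bonds, (45) at `U` in velocity currency, `U` curve-critical for (5) on the fibre ⇒ `d∕dt A(U·exp(tX))∣₀ = 0`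
for every joint-kernel direction `X` — the TOP-DOMAIN form of n07-w2 g0's tangent form (no global guard). [cite: Balaban1985Variational, (82)–(83) p.290, (141) p.299, Prop. 8 p.304, (45) p.285; Balaban1988Convergent, (2.10)–(2.12) p.256] -/
theorem hasDerivAt_wilsonAction4_expChart_of_isCritOnFibre_of_small_on_closedBelow_of_rightInverse (h𝔹 : ∀ j, k < j → 𝔹 j = ∅)
    (hk : k ≤ (F.P K).m + (F.P K).K) (hU : AgreeOn 𝔹 (avgFamily (avOfRecord F N K) U) W)
    (S : (i : ℕ) → Set (PBond (F.P K) i))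
    (hS : ∀ (i : ℕ) (c : PBond (F.P K) (i + 1)), i + 1 ≤ k → c ∈ S (i + 1) →
      ∀ b : PBond (F.P K) i, (blockOf b.src = c.src ∨ blockOf b.src = c.tgt) → b ∈ S i)
    (hg : ∀ (i : ℕ) (c : PBond (F.P K) (i + 1)), i + 1 ≤ k → c ∈ S (i + 1) →
      Small (expMeanLogSU (n := Fin N)) (avgFamily (avOfRecord F N K) U i) c)
    (h𝔹S : ∀ j, j ≤ k → bondsOf (𝔹 j) ⊆ S j)
    (hH : ∀ τ : (j : ℕ) → PBond (F.P K) j → lieSU (Fin N), ∃ X : PBond (F.P K) 0 → lieSU (Fin N), ∀ j, j ≤ k → ∀ c ∈ bondsOf (𝔹 j),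
      HasDerivAt (fun t : ℝ => ((avgFamily (avOfRecord F N K) (expChart U (t • X)) j c : SU N) : Matrix (Fin N) (Fin N) ℂ))
        (((W j c : SU N) : Matrix (Fin N) (Fin N) ℂ) * ((τ j c : lieSU (Fin N)) : Matrix (Fin N) (Fin N) ℂ)) 0)
    (hcrit : IsCritOnFibre F N K 𝔹 W U) {X : PBond (F.P K) 0 → lieSU (Fin N)}
    (hX : ∀ j, j ≤ k → ∀ c ∈ bondsOf (𝔹 j),
      HasDerivAt (fun t : ℝ => ((avgFamily (avOfRecord F N K) (expChart U (t • X)) j c : SU N) : Matrix (Fin N) (Fin N) ℂ)) 0 0) :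
    HasDerivAt (fun t : ℝ => wilsonAction4 (expChart U (t • X))) 0 0 :=
  hasDerivAt_wilsonAction4_expChart_of_isCritOnFibre_of_smooth_of_rightInverse h𝔹 hU
    (contDiffAt_constrained_of_small_on_closedBelow hk S hS hg h𝔹S) hH hcrit hX

open Summit.QuantumFields.YangMills.BalabanUVNodes.N07MultiScaleLiftsRightInverse
  (exists_velocity_preimage_of_levelLifts isFibreChartNear_msChart_of_levelLifts hasDerivAt_wilsonAction4_expChart_of_isCritOnFibre_of_levelLifts)

/-- ★★ **PER-LEVEL LIFTS + SUPPORT-LOCALISED GUARD ⇒ (45) AT `U`** (`exists_velocity_preimage_of_levelLifts` with its differentiability clause supplied by §3).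
[cite: Balaban1984PropagatorsII, p.228; Balaban1985Variational, (45) p.285, (83) p.290] -/
theorem exists_velocity_preimage_of_levelLifts_of_small_on_closedBelow (hk : k ≤ (F.P K).m + (F.P K).K) (hU : AgreeOn 𝔹 (avgFamily (avOfRecord F N K) U) W)
    (S : (i : ℕ) → Set (PBond (F.P K) i))
    (hS : ∀ (i : ℕ) (c : PBond (F.P K) (i + 1)), i + 1 ≤ k → c ∈ S (i + 1) →
      ∀ b : PBond (F.P K) i, (blockOf b.src = c.src ∨ blockOf b.src = c.tgt) → b ∈ S i)
    (hg : ∀ (i : ℕ) (c : PBond (F.P K) (i + 1)), i + 1 ≤ k → c ∈ S (i + 1) →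
      Small (expMeanLogSU (n := Fin N)) (avgFamily (avOfRecord F N K) U i) c)
    (h𝔹S : ∀ j, j ≤ k → bondsOf (𝔹 j) ⊆ S j)
    (hlift : ∀ j, j ≤ k → ∀ σ : PBond (F.P K) j → lieSU (Fin N), ∃ X : PBond (F.P K) 0 → lieSU (Fin N),
      (∀ c ∈ bondsOf (𝔹 j), HasDerivAt (fun t : ℝ => ((avgFamily (avOfRecord F N K) (expChart U (t • X)) j c : SU N) : Matrix (Fin N) (Fin N) ℂ))
        (((W j c : SU N) : Matrix (Fin N) (Fin N) ℂ) * ((σ c : lieSU (Fin N)) : Matrix (Fin N) (Fin N) ℂ)) 0) ∧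
      (∀ i, i < j → ∀ c ∈ bondsOf (𝔹 i), HasDerivAt (fun t : ℝ => ((avgFamily (avOfRecord F N K) (expChart U (t • X)) i c : SU N) : Matrix (Fin N) (Fin N) ℂ)) 0 0))
    (τ : (j : ℕ) → PBond (F.P K) j → lieSU (Fin N)) :
    ∃ X : PBond (F.P K) 0 → lieSU (Fin N), ∀ j, j ≤ k → ∀ c ∈ bondsOf (𝔹 j),
      HasDerivAt (fun t : ℝ => ((avgFamily (avOfRecord F N K) (expChart U (t • X)) j c : SU N) : Matrix (Fin N) (Fin N) ℂ))
        (((W j c : SU N) : Matrix (Fin N) (Fin N) ℂ) * ((τ j c : lieSU (Fin N)) : Matrix (Fin N) (Fin N) ℂ)) 0 :=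
  exists_velocity_preimage_of_levelLifts hU
    (fun j hj c hc => (contDiffAt_constrained_of_small_on_closedBelow hk S hS hg h𝔹S j hj c hc).differentiableAt one_ne_zero) hlift τ

/-- ★★ **PER-LEVEL LIFTS + SUPPORT-LOCALISED GUARD ⇒ 35a's `IsFibreChartNear`** (`isFibreChartNear_msChart_of_levelLifts` with `hsm` supplied by §3).
[cite: Balaban1985Variational, (45)–(48) p.285, Prop. 3 p.289, (82)–(83) p.290; Balaban1984PropagatorsII, p.228] -/
theorem isFibreChartNear_msChart_of_levelLifts_of_small_on_closedBelow (h𝔹 : ∀ j, k < j → 𝔹 j = ∅) (hk : k ≤ (F.P K).m + (F.P K).K)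
    (hU : AgreeOn 𝔹 (avgFamily (avOfRecord F N K) U) W)
    (S : (i : ℕ) → Set (PBond (F.P K) i))
    (hS : ∀ (i : ℕ) (c : PBond (F.P K) (i + 1)), i + 1 ≤ k → c ∈ S (i + 1) →
      ∀ b : PBond (F.P K) i, (blockOf b.src = c.src ∨ blockOf b.src = c.tgt) → b ∈ S i)
    (hg : ∀ (i : ℕ) (c : PBond (F.P K) (i + 1)), i + 1 ≤ k → c ∈ S (i + 1) →
      Small (expMeanLogSU (n := Fin N)) (avgFamily (avOfRecord F N K) U i) c)
    (h𝔹S : ∀ j, j ≤ k → bondsOf (𝔹 j) ⊆ S j)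
    (hlift : ∀ j, j ≤ k → ∀ σ : PBond (F.P K) j → lieSU (Fin N), ∃ X : PBond (F.P K) 0 → lieSU (Fin N),
      (∀ c ∈ bondsOf (𝔹 j), HasDerivAt (fun t : ℝ => ((avgFamily (avOfRecord F N K) (expChart U (t • X)) j c : SU N) : Matrix (Fin N) (Fin N) ℂ))
        (((W j c : SU N) : Matrix (Fin N) (Fin N) ℂ) * ((σ c : lieSU (Fin N)) : Matrix (Fin N) (Fin N) ℂ)) 0) ∧
      (∀ i, i < j → ∀ c ∈ bondsOf (𝔹 i), HasDerivAt (fun t : ℝ => ((avgFamily (avOfRecord F N K) (expChart U (t • X)) i c : SU N) : Matrix (Fin N) (Fin N) ℂ)) 0 0)) :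
    IsFibreChartNear F N K 𝔹 W U (msChart F N K k 𝔹 W U) (fderiv ℝ (msChart F N K k 𝔹 W U) 0) :=
  isFibreChartNear_msChart_of_levelLifts h𝔹 hU (contDiffAt_constrained_of_small_on_closedBelow hk S hS hg h𝔹S) hlift

/-- ★★★ **CURVE-CRITICAL ⇒ TANGENT-CRITICAL ON A MULTI-SCALE FIBRE FROM PER-LEVEL LIFTS UNDER A SUPPORT-LOCALISED GUARD**: the TOP-DOMAIN form of n07-w2 g0's
`hasDerivAt_wilsonAction4_expChart_of_isCritOnFibre_of_levelLifts` — its `hsm` replaced by the (0.4) guard on a downward-closed bond family containing the constrained bonds; what remains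
displayed is the per-level LIFTS. [cite: Balaban1985Variational, (82)–(83) p.290, (141) p.299, Prop. 8 p.304, (45) p.285; Balaban1984PropagatorsII, p.228; Balaban1988Convergent, (2.10)–(2.12) p.256] -/
theorem hasDerivAt_wilsonAction4_expChart_of_isCritOnFibre_of_levelLifts_of_small_on_closedBelow (h𝔹 : ∀ j, k < j → 𝔹 j = ∅)
    (hk : k ≤ (F.P K).m + (F.P K).K) (hU : AgreeOn 𝔹 (avgFamily (avOfRecord F N K) U) W)
    (S : (i : ℕ) → Set (PBond (F.P K) i))
    (hS : ∀ (i : ℕ) (c : PBond (F.P K) (i + 1)), i + 1 ≤ k → c ∈ S (i + 1) →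
      ∀ b : PBond (F.P K) i, (blockOf b.src = c.src ∨ blockOf b.src = c.tgt) → b ∈ S i)
    (hg : ∀ (i : ℕ) (c : PBond (F.P K) (i + 1)), i + 1 ≤ k → c ∈ S (i + 1) →
      Small (expMeanLogSU (n := Fin N)) (avgFamily (avOfRecord F N K) U i) c)
    (h𝔹S : ∀ j, j ≤ k → bondsOf (𝔹 j) ⊆ S j)
    (hlift : ∀ j, j ≤ k → ∀ σ : PBond (F.P K) j → lieSU (Fin N), ∃ X : PBond (F.P K) 0 → lieSU (Fin N),
      (∀ c ∈ bondsOf (𝔹 j), HasDerivAt (fun t : ℝ => ((avgFamily (avOfRecord F N K) (expChart U (t • X)) j c : SU N) : Matrix (Fin N) (Fin N) ℂ))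
        (((W j c : SU N) : Matrix (Fin N) (Fin N) ℂ) * ((σ c : lieSU (Fin N)) : Matrix (Fin N) (Fin N) ℂ)) 0) ∧
      (∀ i, i < j → ∀ c ∈ bondsOf (𝔹 i), HasDerivAt (fun t : ℝ => ((avgFamily (avOfRecord F N K) (expChart U (t • X)) i c : SU N) : Matrix (Fin N) (Fin N) ℂ)) 0 0))
    (hcrit : IsCritOnFibre F N K 𝔹 W U) {X : PBond (F.P K) 0 → lieSU (Fin N)}
    (hX : ∀ j, j ≤ k → ∀ c ∈ bondsOf (𝔹 j),
      HasDerivAt (fun t : ℝ => ((avgFamily (avOfRecord F N K) (expChart U (t • X)) j c : SU N) : Matrix (Fin N) (Fin N) ℂ)) 0 0) :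
    HasDerivAt (fun t : ℝ => wilsonAction4 (expChart U (t • X))) 0 0 :=
  hasDerivAt_wilsonAction4_expChart_of_isCritOnFibre_of_levelLifts h𝔹 hU (contDiffAt_constrained_of_small_on_closedBelow hk S hS hg h𝔹S) hlift hcrit hX

end Constrained

end Summit.QuantumFields.YangMills.BalabanUVNodes.N07AveragingLocalSmooth

end
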